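import Literature.Probability.LatticeModels.TorusCutsetConnectivity
import Literature.Combinatorics.Enumerative.ConnectedSetsCoveringWords
import Mathlib.Analysis.SpecificLimits.Normed
import HarnessLib

/-!
# Counting contours on the 2-torus: Fröhlich–Lieb's Theorem 1.1 made volume-uniform

Topic `Probability/LatticeModels`; continues `TorusCutsetConnectivity`. Fröhlich–Lieb 1978,
Thm. 1.1 ("Peierls argument"): "Given some fixed length `2l`, well known combinatorics shows that
there are no more than `2(l-1)3^{2l-2}` contours of length `2l`, provided `Λ` is large enough,
depending on `m` and `n`. (The factor `3^{2l-2}` comes from a standard argument and the fact that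
all contours consist of one or two closed pieces. The factor `2(l-2)` comes from the fact that each
contour must separate `m` from `n`)." On the torus `(ℤ/Lℤ)²` we index contours by the separating
sets `A` (`m ∈ A ∌ n`, `A` and `Aᶜ` connected: `IsSeparatingSet`), `γ = ∂A = cutKeys A`, and prove
an exponential bound UNIFORM in `L`, `m`, `n` (constants `19 = |moves| + 1` instead of `3`):

* `plaqVec`, `KeyMove = (Fin 3 × Fin 3) × Fin 2`, `keyStep` — the 18 local moves on edge keys
  (`(x,k) ↦ (x - vᵢ + vⱼ, k')`, `v ∈ {0, e₀, e₁}`); every plaquette adjacency is a move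
  (`exists_keyStep_of_plaqAdj`), every move is undone by a move (`keyStep_symm`);
* `cutKeys_inj` — on the (connected) torus a cut determines its set given one point;
* **short contours** `|∂A| = ℓ < L`: `∂A` is step-connected from one of the `2ℓ` anchors above `m`
  or `n` (`cutKeys_isStepConnected_anchor`), hence **`card_separating_short_le`**:
  `#{A : |∂A| = ℓ} ≤ 2ℓ · 19^{2(ℓ-1)}`;
* **long contours** `ℓ ≥ L` (where winding pieces occur): `∂A ∪ row(n) ∪ col(m)` is step-connected
  from the key above `m` (`isStepConnected_augment`), hence **`card_separating_long_le`**: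
  `#{A : |∂A| = ℓ} ≤ (ℓ + 2L + 1) · 19^{2(ℓ+2L-1)} · 4^L ≤ 4ℓ · (4·19⁶)^ℓ` for `ℓ ≥ L`;
* **`sum_pow_card_cutKeys_le`** — for any family of separating sets and `0 ≤ θ`,
  `Σ_A θ^{|∂A|} ≤ Σ_{ℓ ≥ 1} 4ℓ (4·19⁶ θ)^ℓ ≤ 4ρ/(1-ρ)²`, `ρ = 4·19⁶·θ < 1`
  (`sum_pow_card_cutKeys_le_geom`): the Peierls contour series converges uniformly in the volume.

Pure finite combinatorics; no named facts, no sorries.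

## References

* J. Fröhlich, E. H. Lieb, Comm. Math. Phys. **60** (1978) 233–267, §I.C Thm. 1.1 and its proof,
  eqs. (1.31)–(1.33). [FrohlichLieb1978]
* S. Friedli, Y. Velenik, *Statistical Mechanics of Lattice Systems*, CUP 2017, Lemma 3.38,
  eqs. (3.39), (3.48)–(3.49). [FriedliVelenik2017]
* Á. Timár, Proc. Amer. Math. Soc. **141** (2013) 475–480, Lemma 1. [Timar2012]
-/

noncomputable section

open Finset Literature.Combinatorics.Enumerative
open scoped BigOperators

namespace Literature.Probability.LatticeModels

variable {L : ℕ} [NeZero L]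

/-! ### The local moves on edge keys -/

section Moves

variable (L)

/-- The three corner vectors `0, e₀, e₁` of a plaquette relative to its lower-left corner.
[cite: FrohlichLieb1978, Thm. 1.1] -/
def plaqVec (i : Fin 3) : TorusSite 2 L := ![0, Pi.single 0 1, Pi.single 1 1] i

/-- The move alphabet on edge keys: `((i, j), k')` sends `(x, k)` to `(x - vᵢ + vⱼ, k')`
(`18` moves; every pair of keys on a common plaquette is related by one).
[cite: FrohlichLieb1978, Thm. 1.1] -/
abbrev KeyMove : Type := (Fin 3 × Fin 3) × Fin 2

/-- Applying a move to a key. [cite: FrohlichLieb1978, Thm. 1.1] -/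
def keyStep (μ : KeyMove) (e : TorusSite 2 L × Fin 2) : TorusSite 2 L × Fin 2 :=
  (e.1 - plaqVec L μ.1.1 + plaqVec L μ.1.2, μ.2)

variable {L}

omit [NeZero L] in
/-- Every move is undone by a move. [cite: FriedliVelenik2017, Lemma 3.38] -/
theorem keyStep_symm (μ : KeyMove) (e : TorusSite 2 L × Fin 2) :
    ∃ μ' : KeyMove, keyStep L μ' (keyStep L μ e) = e :=
  ⟨((μ.1.2, μ.1.1), e.2), by simp [keyStep]⟩

omit [NeZero L] in
/-- The keys of a plaquette in corner coordinates. [cite: FrohlichLieb1978, Thm. 1.1] -/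
theorem exists_plaqVec_of_mem_plaqKeys {y : TorusSite 2 L} {e : TorusSite 2 L × Fin 2}
    (he : e ∈ plaqKeys L y) : ∃ (i : Fin 3) (k : Fin 2), e = (y + plaqVec L i, k) := by
  simp only [plaqKeys, mem_insert, mem_singleton] at he
  rcases he with rfl | rfl | rfl | rfl
  · exact ⟨0, 0, by simp [plaqVec]⟩
  · exact ⟨2, 0, by simp [plaqVec]⟩
  · exact ⟨0, 1, by simp [plaqVec]⟩
  · exact ⟨1, 1, by simp [plaqVec]⟩

omit [NeZero L] in
/-- **Plaquette-adjacent keys differ by a move.** [cite: FrohlichLieb1978, Thm. 1.1] -/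
theorem exists_keyStep_of_plaqAdj {e e' : TorusSite 2 L × Fin 2} (h : PlaqAdj L e e') :
    ∃ μ : KeyMove, keyStep L μ e = e' := by
  obtain ⟨y, he, he'⟩ := h
  obtain ⟨i, k, rfl⟩ := exists_plaqVec_of_mem_plaqKeys he
  obtain ⟨j, k', rfl⟩ := exists_plaqVec_of_mem_plaqKeys he'
  exact ⟨((i, j), k'), by simp [keyStep]⟩

omit [NeZero L] in
/-- The move one step in direction `e₀` keeping the orientation. [cite: FrohlichLieb1978, Thm. 1.1] -/
theorem keyStep_right (x : TorusSite 2 L) (k : Fin 2) :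
    keyStep L ((0, 1), k) (x, k) = (x + Pi.single 0 1, k) := by
  simp [keyStep, plaqVec]

omit [NeZero L] in
/-- The move one step in direction `e₁` keeping the orientation. [cite: FrohlichLieb1978, Thm. 1.1] -/
theorem keyStep_up (x : TorusSite 2 L) (k : Fin 2) :
    keyStep L ((0, 2), k) (x, k) = (x + Pi.single 1 1, k) := by
  simp [keyStep, plaqVec]

omit [NeZero L] in
/-- The corner move: same site, other orientation. [cite: FrohlichLieb1978, Thm. 1.1] -/
theorem keyStep_turn (x : TorusSite 2 L) (k k' : Fin 2) :
    keyStep L ((0, 0), k') (x, k) = (x, k') := by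
  simp [keyStep, plaqVec]

end Moves

/-! ### Separating sets and the injectivity of `A ↦ ∂A` -/

section Separating

variable (L)

/-- **A separating set**: `m ∈ A`, `n ∉ A`, `A` connected from `m` through nearest-neighbour steps
inside `A`, `Aᶜ` connected from `n` inside `Aᶜ` (Fröhlich–Lieb's `Λ_m(γ)` with its contour
`γ = ∂A`; `Λ_m`, `Λ_n` connected = "one or two closed pieces"). [cite: FrohlichLieb1978, §I.C Definition 1] -/
def IsSeparatingSet (A : Finset (TorusSite 2 L)) (m n : TorusSite 2 L) : Prop :=
  m ∈ A ∧ n ∉ A ∧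
    (∀ b ∈ A, Relation.ReflTransGen (fun x y => (torusGraph 2 L).Adj x y ∧ y ∈ A) m b) ∧
    ∀ b, b ∉ A → Relation.ReflTransGen (fun x y => (torusGraph 2 L).Adj x y ∧ y ∉ A) n b

variable {L}

omit [NeZero L] in
/-- Coordinates of `x + a e₀ + b e₁`. [cite: FriedliVelenik2017, §3.1] -/
theorem add_nsmul_add_nsmul_eq (x : TorusSite 2 L) (a b : ℕ) :
    x + a • (Pi.single 0 1 : TorusSite 2 L) + b • (Pi.single 1 1 : TorusSite 2 L) =
      siteMk L (x 0 + a) (x 1 + b) := by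
  ext i; fin_cases i <;> simp

/-- Every site is `m + a e₀ + b e₁` with `a = val(x₀ - m₀)`, `b = val(x₁ - m₁)`.
[cite: FriedliVelenik2017, §3.1] -/
theorem eq_add_nsmul_add_nsmul (m x : TorusSite 2 L) :
    x = m + (x 0 - m 0).val • (Pi.single 0 1 : TorusSite 2 L) +
      (x 1 - m 1).val • (Pi.single 1 1 : TorusSite 2 L) := by
  rw [add_nsmul_add_nsmul_eq, ZMod.natCast_zmod_val, ZMod.natCast_zmod_val, add_sub_cancel,
    add_sub_cancel, siteMk_eta]

/-- **A cut determines its set given one point** (the torus graph is connected).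
[cite: FrohlichLieb1978, §I.C Definition 1] -/
theorem cutKeys_inj {A A' : Finset (TorusSite 2 L)} (h : cutKeys L A = cutKeys L A')
    {m : TorusSite 2 L} (hm : m ∈ A) (hm' : m ∈ A') : A = A' := by
  have hstep : ∀ (y : TorusSite 2 L) (k : Fin 2), (y ∈ A ↔ y ∈ A') →
      (y + Pi.single k 1 ∈ A ↔ y + Pi.single k 1 ∈ A') := by
    intro y k hy
    have h1 := (mem_cutKeys (L := L) (A := A) (e := (y, k)))
    have h2 := (mem_cutKeys (L := L) (A := A') (e := (y, k)))
    rw [h] at h1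
    simp only at h1 h2
    tauto
  have hdir : ∀ (y : TorusSite 2 L) (k : Fin 2) (a : ℕ), (y ∈ A ↔ y ∈ A') →
      (y + a • Pi.single k 1 ∈ A ↔ y + a • Pi.single k 1 ∈ A') := by
    intro y k a hy
    induction a with
    | zero => rwa [zero_nsmul, add_zero]
    | succ a ih => rw [succ_nsmul, ← add_assoc]; exact hstep _ _ ih
  ext x
  rw [eq_add_nsmul_add_nsmul m x]
  exact hdir _ _ _ (hdir _ _ _ ⟨fun _ => hm', fun _ => hm⟩)

end Separating

/-! ### Short contours are step-connected from an anchor above `m` or `n` -/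

section Short

/-- **Short contours.** For a separating set with `|∂A| < L` (`L ≥ 2`), the cut `∂A` is
step-connected (for the 18 plaquette moves) from the vertical key `t` steps above `m`, or from the
one `t` steps above `n`, for some `t < |∂A|`. [cite: FrohlichLieb1978, Thm. 1.1] -/
theorem cutKeys_isStepConnected_anchor (hL : 1 < L) {A : Finset (TorusSite 2 L)}
    {m n : TorusSite 2 L} (hA : IsSeparatingSet L A m n) (hcard : (cutKeys L A).card < L) :
    ∃ t : ℕ, t < (cutKeys L A).card ∧
      (IsStepConnected (keyStep L) (cutKeys L A) (m + t • Pi.single 1 1, (1 : Fin 2)) ∨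
        IsStepConnected (keyStep L) (cutKeys L A) (n + t • Pi.single 1 1, (1 : Fin 2))) := by
  obtain ⟨hm, hn, hcA, hcAc⟩ := hA
  obtain ⟨r₀, hr₀⟩ := exists_row_avoiding (cutKeys L A) hcard
  obtain ⟨c₀, hc₀⟩ := exists_col_avoiding (cutKeys L A) hcard
  have hconn : ∀ a ∈ cutKeys L A, IsStepConnected (keyStep L) (cutKeys L A) a := by
    intro a ha
    refine ⟨ha, fun b hb => ?_⟩
    have h := cutKeys_plaqConnected hL hcA hcAc hm hn (r₀ := r₀) (c₀ := c₀)
      (fun e he hh => hr₀ e he hh.2) (fun e he hh => hc₀ e he hh.2) ha hb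
    clear hb
    induction h with
    | refl => exact Relation.ReflTransGen.refl
    | tail _ he' ih => exact ih.tail ⟨he'.1, exists_keyStep_of_plaqAdj he'.2⟩
  obtain ⟨t, ht, hmem | hmem⟩ := exists_anchor_of_card_lt hm hn hcard
  · exact ⟨t, ht, Or.inl (hconn _ hmem)⟩
  · exact ⟨t, ht, Or.inr (hconn _ hmem)⟩

/-- The anchors: vertical keys less than `ℓ` steps above `m` or `n`.
[cite: FrohlichLieb1978, Thm. 1.1] -/
def anchors (m n : TorusSite 2 L) (ℓ : ℕ) : Finset (TorusSite 2 L × Fin 2) :=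
  (range ℓ).image (fun t => (m + t • Pi.single 1 1, (1 : Fin 2))) ∪
    (range ℓ).image (fun t => (n + t • Pi.single 1 1, (1 : Fin 2)))

omit [NeZero L] in
/-- There are at most `2ℓ` anchors. [cite: FrohlichLieb1978, Thm. 1.1] -/
theorem card_anchors_le (m n : TorusSite 2 L) (ℓ : ℕ) : (anchors m n ℓ).card ≤ 2 * ℓ := by
  unfold anchors
  refine (card_union_le _ _).trans ?_
  have h1 := card_image_le (s := range ℓ) (f := fun t => (m + t • (Pi.single 1 1 : TorusSite 2 L), (1 : Fin 2)))
  have h2 := card_image_le (s := range ℓ) (f := fun t => (n + t • (Pi.single 1 1 : TorusSite 2 L), (1 : Fin 2)))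
  rw [card_range] at h1 h2
  omega

/-- **Counting short contours: `#{A separating : |∂A| = ℓ} ≤ 2ℓ · 19^{2(ℓ-1)}` for `ℓ < L`.**
(Friedli–Velenik (3.39): anchor × covering-word entropy.) [cite: FrohlichLieb1978, Thm. 1.1]
[cite: FriedliVelenik2017, eq. (3.39)] -/
theorem card_separating_short_le (hL : 1 < L) (m n : TorusSite 2 L) {ℓ : ℕ} (hℓ : ℓ < L)
    (𝒜 : Finset (Finset (TorusSite 2 L)))
    (h𝒜 : ∀ A ∈ 𝒜, IsSeparatingSet L A m n ∧ (cutKeys L A).card = ℓ) :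
    𝒜.card ≤ 2 * ℓ * 19 ^ (2 * (ℓ - 1)) := by
  classical
  have hinj : Set.InjOn (fun A => cutKeys L A) 𝒜 := fun A hA A' hA' h =>
    cutKeys_inj h (h𝒜 A hA).1.1 (h𝒜 A' hA').1.1
  rw [← card_image_of_injOn hinj]
  have hS : ∀ S ∈ 𝒜.image (fun A => cutKeys L A), S.card = ℓ ∧
      ∃ a ∈ anchors m n ℓ, IsStepConnected (keyStep L) S a := by
    intro S hS
    obtain ⟨A, hA, rfl⟩ := mem_image.1 hS
    obtain ⟨hsep, hcardA⟩ := h𝒜 A hA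
    refine ⟨hcardA, ?_⟩
    obtain ⟨t, ht, h | h⟩ := cutKeys_isStepConnected_anchor hL hsep (hcardA ▸ hℓ)
    · exact ⟨_, mem_union_left _ (mem_image.2 ⟨t, mem_range.2 (hcardA ▸ ht), rfl⟩), h⟩
    · exact ⟨_, mem_union_right _ (mem_image.2 ⟨t, mem_range.2 (hcardA ▸ ht), rfl⟩), h⟩
  refine (card_le_mul_pow_of_stepConnected (keyStep L) keyStep_symm (anchors m n ℓ) ℓ _ hS).trans ?_
  have hcard : Fintype.card KeyMove + 1 = 19 := by simp [KeyMove, Fintype.card_prod]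
  rw [hcard]
  exact Nat.mul_le_mul_right _ (card_anchors_le m n ℓ)

end Short

/-! ### Long contours: the cut together with the row of `n` and the column of `m` -/

section Long

variable (L)

/-- The horizontal keys of the row `r`. [cite: FrohlichLieb1978, Thm. 1.1] -/
def rowKeys (r : ZMod L) : Finset (TorusSite 2 L × Fin 2) :=
  univ.filter fun e => e.2 = 0 ∧ e.1 1 = r

/-- The vertical keys of the column `c`. [cite: FrohlichLieb1978, Thm. 1.1] -/
def colKeys (c : ZMod L) : Finset (TorusSite 2 L × Fin 2) :=
  univ.filter fun e => e.2 = 1 ∧ e.1 0 = c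

variable {L}

/-- Membership in `rowKeys`. [cite: FrohlichLieb1978, Thm. 1.1] -/
@[simp] theorem mem_rowKeys {r : ZMod L} {e : TorusSite 2 L × Fin 2} :
    e ∈ rowKeys L r ↔ e.2 = 0 ∧ e.1 1 = r := by
  simp [rowKeys]

/-- Membership in `colKeys`. [cite: FrohlichLieb1978, Thm. 1.1] -/
@[simp] theorem mem_colKeys {c : ZMod L} {e : TorusSite 2 L × Fin 2} :
    e ∈ colKeys L c ↔ e.2 = 1 ∧ e.1 0 = c := by
  simp [colKeys]

/-- A row has at most `L` horizontal keys. [cite: FrohlichLieb1978, Thm. 1.1] -/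
theorem card_rowKeys_le (r : ZMod L) : (rowKeys L r).card ≤ L := by
  have hsub : rowKeys L r ⊆ (univ : Finset (ZMod L)).image fun j => (siteMk L j r, (0 : Fin 2)) := by
    rintro ⟨x, k⟩ he
    rw [mem_rowKeys] at he
    obtain ⟨rfl, rfl⟩ := he
    exact mem_image.2 ⟨x 0, mem_univ _, by rw [siteMk_eta]⟩
  refine (card_le_card hsub).trans (card_image_le.trans ?_)
  rw [card_univ, ZMod.card]

/-- A column has at most `L` vertical keys. [cite: FrohlichLieb1978, Thm. 1.1] -/
theorem card_colKeys_le (c : ZMod L) : (colKeys L c).card ≤ L := by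
  have hsub : colKeys L c ⊆ (univ : Finset (ZMod L)).image fun s => (siteMk L c s, (1 : Fin 2)) := by
    rintro ⟨x, k⟩ he
    rw [mem_colKeys] at he
    obtain ⟨rfl, rfl⟩ := he
    exact mem_image.2 ⟨x 1, mem_univ _, by rw [siteMk_eta]⟩
  refine (card_le_card hsub).trans (card_image_le.trans ?_)
  rw [card_univ, ZMod.card]

omit [NeZero L] in
/-- `x + t e₁` in coordinates. [cite: FriedliVelenik2017, §3.1] -/
theorem add_nsmul_single_one_eq (x : TorusSite 2 L) (t : ℕ) :
    x + t • (Pi.single 1 1 : TorusSite 2 L) = siteMk L (x 0) (x 1 + t) := by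
  ext i; fin_cases i <;> simp

omit [NeZero L] in
/-- `x + t e₀` in coordinates. [cite: FriedliVelenik2017, §3.1] -/
theorem add_nsmul_single_zero_eq (x : TorusSite 2 L) (t : ℕ) :
    x + t • (Pi.single 0 1 : TorusSite 2 L) = siteMk L (x 0 + t) (x 1) := by
  ext i; fin_cases i <;> simp

/-- **Long contours: the augmented key set is step-connected.** For a separating set `A`
(`L ≥ 2`), the cut `∂A` together with the horizontal keys of the row of `n` and the vertical keys of
the column of `m` is step-connected from the key `(m, 1)` (Timár's lemma with the generating row
of `n` and column of `m`: a Ξ-step along that row/column is replaced by moves inside the added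
keys; and `∂A` meets that row or column). [cite: FrohlichLieb1978, Thm. 1.1] [cite: Timar2012, Lemma 1] -/
theorem isStepConnected_augment (hL : 1 < L) {A : Finset (TorusSite 2 L)} {m n : TorusSite 2 L}
    (hA : IsSeparatingSet L A m n) :
    IsStepConnected (keyStep L) (cutKeys L A ∪ (rowKeys L (n 1) ∪ colKeys L (m 0))) (m, 1) := by
  obtain ⟨hm, hn, hcA, hcAc⟩ := hA
  set S := cutKeys L A ∪ (rowKeys L (n 1) ∪ colKeys L (m 0)) with hS
  set R : (TorusSite 2 L × Fin 2) → (TorusSite 2 L × Fin 2) → Prop :=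
    fun e e' => e' ∈ S ∧ ∃ μ : KeyMove, keyStep L μ e = e' with hR
  -- walks along the column of `m` and the row of `n`
  have hcolS : ∀ x : TorusSite 2 L, x 0 = m 0 → (x, (1 : Fin 2)) ∈ S := fun x hx =>
    mem_union_right _ (mem_union_right _ (mem_colKeys.2 ⟨rfl, hx⟩))
  have hrowS : ∀ x : TorusSite 2 L, x 1 = n 1 → (x, (0 : Fin 2)) ∈ S := fun x hx =>
    mem_union_right _ (mem_union_left _ (mem_rowKeys.2 ⟨rfl, hx⟩))
  have hup : ∀ x : TorusSite 2 L, x 0 = m 0 → ∀ t : ℕ,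
      Relation.ReflTransGen R (x, 1) (x + t • Pi.single 1 1, 1) := by
    intro x hx t
    induction t with
    | zero => rw [zero_nsmul, add_zero]
    | succ t ih =>
      refine ih.tail ⟨hcolS _ (by simp [hx]), ((0, 2), 1), ?_⟩
      rw [keyStep_up, succ_nsmul, add_assoc]
  have hright : ∀ x : TorusSite 2 L, x 1 = n 1 → ∀ t : ℕ,
      Relation.ReflTransGen R (x, 0) (x + t • Pi.single 0 1, 0) := by
    intro x hx t
    induction t with
    | zero => rw [zero_nsmul, add_zero]
    | succ t ih =>
      refine ih.tail ⟨hrowS _ (by simp [hx]), ((0, 1), 0), ?_⟩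
      rw [keyStep_right, succ_nsmul, add_assoc]
  -- reaching two keys on the column of `m` / on the row of `n` from one another
  have hcol2 : ∀ x y : TorusSite 2 L, x 0 = m 0 → y 0 = m 0 →
      Relation.ReflTransGen R (x, 1) (y, 1) := by
    intro x y hx hy
    have := hup x hx (y 1 - x 1).val
    rwa [add_nsmul_single_one_eq, ZMod.natCast_zmod_val, add_sub_cancel, hx, ← hy, siteMk_eta] at this
  have hrow2 : ∀ x y : TorusSite 2 L, x 1 = n 1 → y 1 = n 1 →
      Relation.ReflTransGen R (x, 0) (y, 0) := by
    intro x y hx hy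
    have := hright x hx (y 0 - x 0).val
    rwa [add_nsmul_single_zero_eq, ZMod.natCast_zmod_val, add_sub_cancel, hx, ← hy, siteMk_eta] at this
  -- every added key is reachable from `(m, 1)`
  have hreachC : ∀ x : TorusSite 2 L, x 0 = m 0 → Relation.ReflTransGen R (m, 1) (x, 1) :=
    fun x hx => hcol2 m x rfl hx
  have hreachR : ∀ x : TorusSite 2 L, x 1 = n 1 → Relation.ReflTransGen R (m, 1) (x, 0) := by
    intro x hx
    have h1 : Relation.ReflTransGen R (m, 1) (siteMk L (m 0) (n 1), 1) := hreachC _ rfl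
    have h2 : Relation.ReflTransGen R (siteMk L (m 0) (n 1), 1) (siteMk L (m 0) (n 1), 0) :=
      Relation.ReflTransGen.single ⟨hrowS _ rfl, ((0, 0), 0), keyStep_turn _ _ _⟩
    exact (h1.trans h2).trans (hrow2 _ x rfl hx)
  -- every cut key is reachable: through a cut key on the column of `m` or the row of `n`
  have hreachCut : ∀ b ∈ cutKeys L A, Relation.ReflTransGen R (m, 1) b := by
    intro b hb
    obtain ⟨e, he, hpos⟩ := exists_mem_cutKeys_col_or_row (L := L) hm hn
    have h1 : Relation.ReflTransGen R (m, 1) e := by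
      obtain ⟨x, k⟩ := e
      rcases hpos with ⟨hk, hx⟩ | ⟨hk, hx⟩
      · simp only at hk hx; subst hk; exact hreachC x hx
      · simp only at hk hx; subst hk; exact hreachR x hx
    have h2 := cutKeys_xiConnected hL hcA hcAc hm hn (n 1) (m 0) he hb
    refine h1.trans ?_
    clear hb h1
    induction h2 with
    | refl => exact Relation.ReflTransGen.refl
    | @tail x y _ hxy ih =>
      refine ih.trans ?_
      rcases hxy.2 with hp | ⟨⟨hx2, hx1⟩, ⟨hy2, hy1⟩⟩ | ⟨⟨hx2, hx1⟩, ⟨hy2, hy1⟩⟩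
      · exact Relation.ReflTransGen.single ⟨mem_union_left _ hxy.1, exists_keyStep_of_plaqAdj hp⟩
      · obtain ⟨x1, x2⟩ := x
        obtain ⟨y1, y2⟩ := y
        simp only at hx2 hx1 hy2 hy1
        subst hx2; subst hy2
        exact hrow2 x1 y1 hx1 hy1
      · obtain ⟨x1, x2⟩ := x
        obtain ⟨y1, y2⟩ := y
        simp only at hx2 hx1 hy2 hy1
        subst hx2; subst hy2
        exact hcol2 x1 y1 hx1 hy1
  refine ⟨hcolS m rfl, fun b hb => ?_⟩
  rcases mem_union.1 hb with hb | hb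
  · exact hreachCut b hb
  rcases mem_union.1 hb with hb | hb
  · obtain ⟨x, k⟩ := b
    obtain ⟨hk, hx⟩ := mem_rowKeys.1 hb
    simp only at hk hx; subst hk
    exact hreachR x hx
  · obtain ⟨x, k⟩ := b
    obtain ⟨hk, hx⟩ := mem_colKeys.1 hb
    simp only at hk hx; subst hk
    exact hreachC x hx

omit [NeZero L] in
/-- Two sets with the same union and the same intersection with a third set are equal.
[folklore] -/
private theorem tcc2_eq_of_union_inter {α : Type*} [DecidableEq α] {P P' R : Finset α}
    (hu : P ∪ R = P' ∪ R) (hi : P ∩ R = P' ∩ R) : P = P' := by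
  ext x
  have hu' := Finset.ext_iff.1 hu x
  have hi' := Finset.ext_iff.1 hi x
  simp only [mem_union, mem_inter] at hu' hi'
  by_cases hx : x ∈ R <;> tauto

/-- **Counting long contours: `#{A separating : |∂A| = ℓ} ≤ (ℓ + 2L + 1) · 19^{2(ℓ+2L-1)} · 4^L`**
(every volume `L ≥ 2`, every `ℓ`; used for `ℓ ≥ L`). A separating set is recovered from the
step-connected set `∂A ∪ row(n) ∪ col(m)` (at most `ℓ + 2L` keys, anchored at `(m,1)`) together with
the subset `∂A ∩ (row(n) ∪ col(m))`. [cite: FrohlichLieb1978, Thm. 1.1] -/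
theorem card_separating_long_le (hL : 1 < L) (m n : TorusSite 2 L) (ℓ : ℕ)
    (𝒜 : Finset (Finset (TorusSite 2 L)))
    (h𝒜 : ∀ A ∈ 𝒜, IsSeparatingSet L A m n ∧ (cutKeys L A).card = ℓ) :
    𝒜.card ≤ (ℓ + 2 * L + 1) * 19 ^ (2 * (ℓ + 2 * L - 1)) * 4 ^ L := by
  classical
  set RC := rowKeys L (n 1) ∪ colKeys L (m 0) with hRC
  have hr := card_rowKeys_le (L := L) (n 1)
  have hc := card_colKeys_le (L := L) (m 0)
  have hRCcard : RC.card ≤ 2 * L := (card_union_le _ _).trans (by omega)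
  set F : Finset (TorusSite 2 L) → Finset (TorusSite 2 L × Fin 2) × Finset (TorusSite 2 L × Fin 2) :=
    fun A => (cutKeys L A ∪ RC, cutKeys L A ∩ RC) with hF
  have hinj : Set.InjOn F 𝒜 := by
    intro A hA A' hA' h
    simp only [hF, Prod.mk.injEq] at h
    exact cutKeys_inj (tcc2_eq_of_union_inter h.1 h.2) (h𝒜 A hA).1.1 (h𝒜 A' hA').1.1
  set 𝒯 := (range (ℓ + 2 * L + 1)).biUnion fun s =>
    (univ : Finset (Finset (TorusSite 2 L × Fin 2))).filter fun S =>
      S.card = s ∧ IsStepConnected (keyStep L) S (m, 1) with h𝒯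
  have hmaps : ∀ A ∈ 𝒜, F A ∈ 𝒯 ×ˢ RC.powerset := by
    intro A hA
    obtain ⟨hsep, hcardA⟩ := h𝒜 A hA
    refine mem_product.2 ⟨mem_biUnion.2 ⟨(cutKeys L A ∪ RC).card, mem_range.2 ?_,
      mem_filter.2 ⟨mem_univ _, rfl, ?_⟩⟩, mem_powerset.2 inter_subset_right⟩
    · have := card_union_le (cutKeys L A) RC
      omega
    · exact isStepConnected_augment hL hsep
  have hcard𝒯 : 𝒯.card ≤ (ℓ + 2 * L + 1) * 19 ^ (2 * (ℓ + 2 * L - 1)) := by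
    refine card_biUnion_le.trans ?_
    calc ∑ s ∈ range (ℓ + 2 * L + 1), ((univ : Finset (Finset (TorusSite 2 L × Fin 2))).filter
            fun S => S.card = s ∧ IsStepConnected (keyStep L) S (m, 1)).card
        ≤ ∑ s ∈ range (ℓ + 2 * L + 1), 19 ^ (2 * (ℓ + 2 * L - 1)) := by
          refine sum_le_sum fun s hs => ?_
          have h1 := card_le_pow_of_stepConnected (keyStep L) keyStep_symm ((m, 1) : TorusSite 2 L × Fin 2)
            s (univ.filter fun S => S.card = s ∧ IsStepConnected (keyStep L) S (m, 1))
            (fun S hS => (mem_filter.1 hS).2)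
          have hcardM : Fintype.card KeyMove + 1 = 19 := by simp [KeyMove, Fintype.card_prod]
          rw [hcardM] at h1
          refine h1.trans (Nat.pow_le_pow_right (by norm_num) ?_)
          have := mem_range.1 hs
          omega
      _ = (ℓ + 2 * L + 1) * 19 ^ (2 * (ℓ + 2 * L - 1)) := by rw [sum_const, card_range, smul_eq_mul]
  have hcardP : RC.powerset.card ≤ 4 ^ L := by
    rw [card_powerset, show (4 : ℕ) = 2 ^ 2 by norm_num, ← pow_mul]
    exact Nat.pow_le_pow_right (by norm_num) (by omega)
  calc 𝒜.card = (𝒜.image F).card := (card_image_of_injOn hinj).symm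
    _ ≤ (𝒯 ×ˢ RC.powerset).card := card_le_card fun p hp => by
        obtain ⟨A, hA, rfl⟩ := mem_image.1 hp; exact hmaps A hA
    _ = 𝒯.card * RC.powerset.card := card_product _ _
    _ ≤ (ℓ + 2 * L + 1) * 19 ^ (2 * (ℓ + 2 * L - 1)) * 4 ^ L := Nat.mul_le_mul hcard𝒯 hcardP

end Long

/-! ### The contour series is bounded uniformly in the volume -/

section Series

/-- Uniform entropy bound for both regimes. [folklore] -/
private theorem tcc2_count_bound {L ℓ N : ℕ} (hL : 1 < L)
    (hshort : ℓ < L → N ≤ 2 * ℓ * 19 ^ (2 * (ℓ - 1)))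
    (hlong : N ≤ (ℓ + 2 * L + 1) * 19 ^ (2 * (ℓ + 2 * L - 1)) * 4 ^ L) :
    N ≤ 4 * ℓ * (4 * 19 ^ 6) ^ ℓ := by
  rw [mul_pow, ← pow_mul]
  rcases Nat.lt_or_ge ℓ L with h | h
  · refine (hshort h).trans ?_
    have h1 : 19 ^ (2 * (ℓ - 1)) ≤ 19 ^ (6 * ℓ) := Nat.pow_le_pow_right (by norm_num) (by omega)
    have h2 : 1 ≤ 4 ^ ℓ := Nat.one_le_pow _ _ (by norm_num)
    calc 2 * ℓ * 19 ^ (2 * (ℓ - 1)) ≤ 4 * ℓ * 19 ^ (6 * ℓ) := Nat.mul_le_mul (by omega) h1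
      _ = 4 * ℓ * (1 * 19 ^ (6 * ℓ)) := by ring
      _ ≤ 4 * ℓ * (4 ^ ℓ * 19 ^ (6 * ℓ)) := Nat.mul_le_mul_left _ (Nat.mul_le_mul_right _ h2)
  · refine hlong.trans ?_
    have h1 : 19 ^ (2 * (ℓ + 2 * L - 1)) ≤ 19 ^ (6 * ℓ) :=
      Nat.pow_le_pow_right (by norm_num) (by omega)
    have h2 : 4 ^ L ≤ 4 ^ ℓ := Nat.pow_le_pow_right (by norm_num) h
    have h3 : ℓ + 2 * L + 1 ≤ 4 * ℓ := by omega
    calc (ℓ + 2 * L + 1) * 19 ^ (2 * (ℓ + 2 * L - 1)) * 4 ^ L ≤ 4 * ℓ * 19 ^ (6 * ℓ) * 4 ^ ℓ :=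
          Nat.mul_le_mul (Nat.mul_le_mul h3 h1) h2
      _ = 4 * ℓ * (4 ^ ℓ * 19 ^ (6 * ℓ)) := by ring

/-- The number of edge keys of the torus is `2L²`. [cite: FriedliVelenik2017, §3.1] -/
theorem card_keys : Fintype.card (TorusSite 2 L × Fin 2) = 2 * L ^ 2 := by
  rw [Fintype.card_prod, Fintype.card_fin, Fintype.card_fun, ZMod.card, Fintype.card_fin]
  ring

/-- **Fröhlich–Lieb Theorem 1.1 on the torus, uniformly in the volume.** For every family `𝒜` of
separating sets of `m` from `n` on `(ℤ/Lℤ)²` (`L ≥ 2`) and every `θ ≥ 0`: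
`Σ_{A ∈ 𝒜} θ^{|∂A|} ≤ Σ_{ℓ=0}^{2L²} 4ℓ (4·19⁶·θ)^ℓ` — at most `4ℓ(4·19⁶)^ℓ` contours of length `ℓ`,
a bound independent of `L`, `m`, `n` (short contours by anchors above `m`, `n` and plaquette
connectedness; long ones through the row of `n` and the column of `m`).
[cite: FrohlichLieb1978, Thm. 1.1, eqs. (1.31)–(1.33)] -/
theorem sum_pow_card_cutKeys_le (hL : 1 < L) (m n : TorusSite 2 L)
    (𝒜 : Finset (Finset (TorusSite 2 L))) (h𝒜 : ∀ A ∈ 𝒜, IsSeparatingSet L A m n) {θ : ℝ}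
    (hθ : 0 ≤ θ) :
    ∑ A ∈ 𝒜, θ ^ (cutKeys L A).card ≤
      ∑ ℓ ∈ range (2 * L ^ 2 + 1), (4 * ℓ : ℝ) * (4 * 19 ^ 6 * θ) ^ ℓ := by
  classical
  have hmaps : ∀ A ∈ 𝒜, (cutKeys L A).card ∈ range (2 * L ^ 2 + 1) := fun A _ =>
    mem_range.2 (Nat.lt_succ_of_le (by rw [← card_keys (L := L)]; exact card_le_univ _))
  rw [← sum_fiberwise_of_maps_to hmaps]
  refine sum_le_sum fun ℓ _ => ?_
  have hfib : ∑ A ∈ 𝒜.filter (fun A => (cutKeys L A).card = ℓ), θ ^ (cutKeys L A).card =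
      ((𝒜.filter fun A => (cutKeys L A).card = ℓ).card : ℝ) * θ ^ ℓ := by
    rw [← nsmul_eq_mul, ← sum_const]
    exact sum_congr rfl fun A hA => by rw [(mem_filter.1 hA).2]
  rw [hfib]
  have hN : ((𝒜.filter fun A => (cutKeys L A).card = ℓ).card : ℝ) ≤ 4 * ℓ * (4 * 19 ^ 6) ^ ℓ := by
    have hfam : ∀ A ∈ 𝒜.filter (fun A => (cutKeys L A).card = ℓ),
        IsSeparatingSet L A m n ∧ (cutKeys L A).card = ℓ := fun A hA =>
      ⟨h𝒜 A (mem_filter.1 hA).1, (mem_filter.1 hA).2⟩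
    have := tcc2_count_bound (N := (𝒜.filter fun A => (cutKeys L A).card = ℓ).card) hL
      (fun h => card_separating_short_le hL m n h _ hfam) (card_separating_long_le hL m n ℓ _ hfam)
    exact_mod_cast this
  calc ((𝒜.filter fun A => (cutKeys L A).card = ℓ).card : ℝ) * θ ^ ℓ
      ≤ 4 * ℓ * (4 * 19 ^ 6) ^ ℓ * θ ^ ℓ := mul_le_mul_of_nonneg_right hN (pow_nonneg hθ _)
    _ = 4 * ℓ * (4 * 19 ^ 6 * θ) ^ ℓ := by rw [mul_pow (4 * 19 ^ 6 : ℝ) θ ℓ]; ring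

/-- **The Peierls contour series converges uniformly in the volume**: with `ρ = 4·19⁶·θ < 1`,
`Σ_{A ∈ 𝒜} θ^{|∂A|} ≤ 4ρ/(1-ρ)²` for every family of separating sets of `m` from `n` on every torus
`(ℤ/Lℤ)²`, `L ≥ 2` (Fröhlich–Lieb (1.32): `Σ_l 2l 3^{2l-2} e^{-2lK} < ∞` for `K > ln 3`).
[cite: FrohlichLieb1978, Thm. 1.1, eq. (1.32)] -/
theorem sum_pow_card_cutKeys_le_geom (hL : 1 < L) (m n : TorusSite 2 L)
    (𝒜 : Finset (Finset (TorusSite 2 L))) (h𝒜 : ∀ A ∈ 𝒜, IsSeparatingSet L A m n) {θ : ℝ}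
    (hθ : 0 ≤ θ) (hρ : 4 * 19 ^ 6 * θ < 1) :
    ∑ A ∈ 𝒜, θ ^ (cutKeys L A).card ≤
      4 * (4 * 19 ^ 6 * θ) / (1 - 4 * 19 ^ 6 * θ) ^ 2 := by
  set ρ : ℝ := 4 * 19 ^ 6 * θ with hρdef
  have hρ0 : 0 ≤ ρ := by positivity
  have hnorm : ‖ρ‖ < 1 := by rwa [Real.norm_of_nonneg hρ0]
  have hsumm : Summable fun k : ℕ => (k : ℝ) * ρ ^ k := by
    simpa [pow_one] using summable_pow_mul_geometric_of_norm_lt_one 1 hnorm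
  refine (sum_pow_card_cutKeys_le hL m n 𝒜 h𝒜 hθ).trans ?_
  have h1 : ∑ ℓ ∈ range (2 * L ^ 2 + 1), (4 * ℓ : ℝ) * ρ ^ ℓ =
      4 * ∑ ℓ ∈ range (2 * L ^ 2 + 1), (ℓ : ℝ) * ρ ^ ℓ := by
    rw [mul_sum]; refine sum_congr rfl fun ℓ _ => by ring
  rw [h1, mul_div_assoc]
  refine mul_le_mul_of_nonneg_left ?_ (by norm_num)
  rw [← tsum_coe_mul_geometric_of_norm_lt_one hnorm]
  exact hsumm.sum_le_tsum _ fun k _ => mul_nonneg (Nat.cast_nonneg _) (pow_nonneg hρ0 _)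

end Series

end Literature.Probability.LatticeModels

end
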